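import Mathlib
import Summits.NavierStokesRegularity.NavierStokesRegularity.Theorems.TaoLadderRungTwoBreakOneShiftTailEstimates
import HarnessLib

/-!
# The quadratic field bounded by the TABLE-SPARSE functional `quadTermLip (A, A) / 2`

The one-shift Banach theorems `exists_surviving_dssWave_of_windowCert_v3 … _v7` bound the quadratic field
`quadTerm_i(k)` — hence the time-Lipschitz constants `R k` of the image tails — by the norm-type estimate
`m² M_α (Λ^k (A_k² + 2A_kA_{k+1}) + Λ^{k-1} A_{k-1}²)` (`abs_quadTerm_le_of_bounds`, `M_α = sup |α|`).  For an
`m = 4`-component circuit table with entries `≤ 1` and absolute row sums `Σ|α| ≈ 3` this loses a factor `≈ 20`,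
and the wake self-map rows of the STAGE-2 certificates (tube radius growth `τ_hi · R` per shift against the
radius allowance `κ`) do NOT hold with it.  The sharp, table-sparse bound is the value analogue of the Lipschitz
functional `quadTermLip`: `2 |quadTerm_i(k)(X)(s)| ≤ quadTermLip ε₀ α A A i k` whenever `|X_{j,k'}(s)| ≤ A k'`
(`two_mul_abs_quadTerm_le_quadTermLip`), i.e. `Σ_{i₁,i₂,μ} |α_{i₁i₂iμ}| Λ^{k-μ₃} A A` term by term; its
geometric envelopes on the wake / above the window are `quadTermLip_wake_le` / `quadTermLip_top_le` with
`D = A`.  Model lattice only (Tao-type averaged cascade); nothing here is about Navier–Stokes.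
[cite: Tao2016AveragedNS, §4 (4.1), (4.8); cell vocabulary, harvest/h2-tao-ladder rung1/STAGE2-LEMMA.md §5
(rate_site), rung1/KERNEL-STAGE3-PLAN.md §6]
-/

noncomputable section

namespace Summit.NavierStokesRegularity.NavierStokesRegularity.Theorems

namespace DSSOneShift

open Set
open Literature.Analysis.FluidPDE Literature.Analysis.FluidPDE.TaoCascade

variable {m : ℕ}

namespace OneShiftFrame

/-- **Table-sparse bound of the quadratic field.**  If `|X_{j,k'}(s)| ≤ A k'` for all `j, k'` (and `A ≥ 0`), then
`2 |quadTerm_i(k)(X)(s)| ≤ quadTermLip ε₀ α A A i k = Σ_{i₁,i₂,μ∈S} |α_{i₁i₂iμ}| (1+ε₀)^{5(k-μ₃)/2} · 2 A A`.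
[cite: Tao2016AveragedNS, §4 (4.1), (4.8); cell vocabulary, harvest/h2-tao-ladder rung1/STAGE2-LEMMA.md §5] -/
theorem two_mul_abs_quadTerm_le_quadTermLip {ε₀ : ℝ} (hε : 0 < 1 + ε₀)
    (α : Fin m → Fin m → Fin m → ℤ × ℤ × ℤ → ℝ) (X : Fin m → ℤ → ℝ → ℝ) {A : ℤ → ℝ} (i : Fin m) (k : ℤ)
    {s : ℝ} (hA : ∀ j k', |X j k' s| ≤ A k') :
    2 * |quadTerm ε₀ α X i k s| ≤ quadTermLip ε₀ α A A i k := by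
  have hterm : ∀ i₁ i₂ μ, |α i₁ i₂ i μ * (1 + ε₀) ^ ((5 : ℝ) * (k - μ.2.2) / 2) *
      (X i₁ (k - μ.2.2 + μ.1) s * X i₂ (k - μ.2.2 + μ.2.1) s)| ≤
      |α i₁ i₂ i μ| * (1 + ε₀) ^ ((5 : ℝ) * (k - μ.2.2) / 2) *
        (A (k - μ.2.2 + μ.1) * A (k - μ.2.2 + μ.2.1)) := by
    intro i₁ i₂ μ
    have hc : 0 ≤ (1 + ε₀) ^ ((5 : ℝ) * (k - μ.2.2) / 2) := Real.rpow_nonneg hε.le _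
    rw [abs_mul, abs_mul, abs_mul, abs_of_nonneg hc]
    refine mul_le_mul_of_nonneg_left ?_ (mul_nonneg (abs_nonneg _) hc)
    exact mul_le_mul (hA _ _) (hA _ _) (abs_nonneg _) ((abs_nonneg _).trans (hA i₁ (k - μ.2.2 + μ.1)))
  have h1 : |quadTerm ε₀ α X i k s| ≤ ∑ i₁ : Fin m, ∑ i₂ : Fin m, ∑ μ ∈ shiftSet,
      |α i₁ i₂ i μ| * (1 + ε₀) ^ ((5 : ℝ) * (k - μ.2.2) / 2) *
        (A (k - μ.2.2 + μ.1) * A (k - μ.2.2 + μ.2.1)) := by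
    unfold quadTerm
    refine (Finset.abs_sum_le_sum_abs _ _).trans (Finset.sum_le_sum fun i₁ _ => ?_)
    refine (Finset.abs_sum_le_sum_abs _ _).trans (Finset.sum_le_sum fun i₂ _ => ?_)
    exact (Finset.abs_sum_le_sum_abs _ _).trans (Finset.sum_le_sum fun μ _ => hterm i₁ i₂ μ)
  have h2 : quadTermLip ε₀ α A A i k = 2 * ∑ i₁ : Fin m, ∑ i₂ : Fin m, ∑ μ ∈ shiftSet,
      |α i₁ i₂ i μ| * (1 + ε₀) ^ ((5 : ℝ) * (k - μ.2.2) / 2) *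
        (A (k - μ.2.2 + μ.1) * A (k - μ.2.2 + μ.2.1)) := by
    unfold quadTermLip
    rw [Finset.mul_sum]
    refine Finset.sum_congr rfl fun i₁ _ => ?_
    rw [Finset.mul_sum]
    refine Finset.sum_congr rfl fun i₂ _ => ?_
    rw [Finset.mul_sum]
    refine Finset.sum_congr rfl fun μ _ => ?_
    ring
  rw [h2]
  linarith

variable (F : OneShiftFrame m)

/-- The window + tail family of an admissible point obeys the table-sparse rate bound: with amplitude bounds
`A` (`|fullFamily u j k' s| ≤ A k'`) and `quadTermLip ε₀ α A A i k ≤ 2 R k` on the tail shells,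
`|quadTerm_i(k)(fullFamily u)(s)| ≤ R k` there — the hypothesis `hR` of `tailRaw_time_lipschitz`,
`tailRaw_mem_tube_of_rows` and `exists_surviving_dssWave_of_windowCert_rows`. [cite: Tao2016AveragedNS, §4 (4.8);
cell vocabulary, harvest/h2-tao-ladder rung1/STAGE2-LEMMA.md §5 (rate_site)] -/
theorem abs_quadTerm_fullFamily_le_of_quadTermLip {ε₀ : ℝ} {α : Fin m → Fin m → Fin m → ℤ × ℤ × ℤ → ℝ}
    (cert : OneShiftWindowCert F ε₀ α) (hε : 0 < 1 + ε₀) (R A : ℤ → ℝ)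
    (hA : ∀ w, F.Adm w → ∀ j k', ∀ s ∈ Icc 0 F.τhi, |F.fullFamily cert w j k' s| ≤ A k')
    (hRrow : ∀ i k, ¬ F.InWindow k → quadTermLip ε₀ α A A i k ≤ 2 * R k)
    {u : F.Space} (hu : F.Adm u) (i : Fin m) {k : ℤ} (hk : ¬ F.InWindow k) {s : ℝ} (hs : s ∈ Icc 0 F.τhi) :
    |quadTerm ε₀ α (F.fullFamily cert u) i k s| ≤ R k := by
  have h := two_mul_abs_quadTerm_le_quadTermLip hε α (F.fullFamily cert u) i k
    (fun j k' => hA u hu j k' s hs)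
  linarith [hRrow i k hk]

end OneShiftFrame

end DSSOneShift

end Summit.NavierStokesRegularity.NavierStokesRegularity.Theorems
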